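import Summits.QuantumFields.YangMills.Theorems.ForcedResponseSkewnessAssembly
import Summits.QuantumFields.YangMills.Theorems.AtomicCalibrationRMirrorCalibrationKDefs
import Summits.QuantumFields.YangMills.Theorems.OnsetCalibrationOnsetVanishes
import Summits.QuantumFields.YangMills.Theorems.SquareRootCeilingsMirrorDomination
import HarnessLib

/-!
# LINE «CofinalFRS» on the leaf `InfiniteVolumeContinuum.HypercubicOSDataFromInfiniteVolume` (stmt-QuantumFields-19868)

Planner seat `ym-idea-11` g18 (D-0145 ideator, lens «wuc»), 2026-08-29, second line of the generation.
bears_on: LADDER-YM R2a-IV (leaf 19868); shares its two N-side cruxes BY NAME with route ForcedResponseSkewness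
(`ResponseLocalisation` stmt-QuantumFields-26871, `RunningCouplingCeiling` stmt-QuantumFields-24275).

## The line
Route ForcedResponseSkewness (FRS) proves `FloorWithScalingLimits → RunningCouplingCeiling → ResponseLocalisation → NT`
(landed `assembly_proof`): floor at `c₀`, asymptotic-freedom ceiling at `c₀+T₀`, first crossing + mean-value theorem,
relative localisation of the Feynman–Hellmann response ⇒ at ONE coupling `c* ∈ (c₀, c₀+T₀)` and on ONE torus both
`Q2 > ε/2` and `Q3(f,θv,v) ≤ −ε/(8T₀)` in the unit `a(c₀)`; then the two SCALING-LIMIT clauses of its residual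
(`Q2 → Φ₂(l)`, `Q3 → Φ₃^f(l)`, uniform on tori: Track-A ∧ IR content, FRS header) transport this to every large `β`.
THIS LINE removes the transport.  It is PROVED here (kernel-checked, sorry-free) that
(1) the WINDOW STEP works on EVERY large torus with thresholds uniform in the window
    (`windowFloors_of_floor_ceiling_localisation`, a port of FRS's `lowerBounds_of_floor_ceiling_localisation_rel`
    Steps 1–5 with the torus left free and the two limit clauses deleted), hence
    `windowFloorsS_of_FRS : FloorRatioFar → RunningCouplingCeiling → ResponseLocalisation → WindowFloorsS`, where
    `FloorRatioFar` is FRS's residual `FloorWithScalingLimits` with BOTH limit clauses deleted (keeps: the clause-(i)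
    floor of the shrinking family, the antitone unit with ratio law `a(c)/a(c+t) → e^{κt}`, the far-field response
    ceiling) — `floorRatioFar_of_floorWithScalingLimits` records that it is weaker;
(2) the SELECTION `cofinalFloorsS_of_windows : WindowFloorsS → WindowLipschitz → CofinalFloorsS`
    (Bolzano–Weierstrass per window + the `L`-uniform Lipschitz-in-`β` input N2 of LINE «CofinalWindows», here for
    Schwartz sources): floors at `(β_k, u_k)` along a strictly increasing odd-torus sequence, `β_k → ∞`, `u_k → 0`.
The leaf quantifies `∃ β_k`; its states are `oddTorusLimitPoints` = limits along ANY strictly increasing odd-torus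
sequence; so `CofinalFloorsS` is what its N-side consumes, and the remaining work is the soft cofinal engine of
LINE «CofinalWindows» (here with a Schwartz three-point source `f`, compact calibrating `v`).

## Stubs (7) and composition
* `stub_responseLocalisation : ForcedResponseSkewness.ResponseLocalisation` — item 26871 BY NAME (FRS deciding crux).
* `stub_runningCouplingCeiling : ForcedResponseSkewness.RunningCouplingCeiling` — item 24275 BY NAME.
* `stub_floorRatioFar : FloorRatioFar` — FRS's residual MINUS its two scaling-limit clauses (still contains NT clause (i)
  for the shrinking family, the ratio law and the IR far-field ceiling; honest: PerturbativeInvisibility-class inside).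
* `stub_windowResponseBound : WindowResponseBound` (REV 4, CORRECTED N2′) — wherever window floors hold (N1's
  property), the coupling derivative of `Q2_(·,L,a c₀)(θv,v)` / `Q3_(·,L,a c₀)(f,θv,v)` is bounded by ONE `K` across every
  window, uniformly in `L`; N2 `WindowLipschitz` FOLLOWS (proved: `windowLipschitz_of_responseBound`).
* `stub_axisMirrorCeilingOnset : AxisMirrorCeilingOnset` (REV E_AM; answers idea-crit-9 #90 P4 (ii)) — item 26791
  `SquareRootCeilings.AxisMirrorCeiling` VERBATIM minus its `∀β`-floor antecedent: the ON-AXIS same-orientation mirror-pair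
  ceiling at sub-onset units (a Hausdorff-moment ceiling on one plaquette's spectral measure).  E `SubOnsetTwoPointCeilingsOnset`
  FOLLOWS by the LANDED reflection-positivity Cauchy–Schwarz `MirrorDomination.abs_cov_le_of_axisMirror` (proved:
  `subOnsetTwoPointCeilingsOnset_of_axisMirrorOnset`); `⇒ 26791` (`axisMirrorCeiling_of_onset`).  [E-wall n = 2, on-axis; open-problem class]
* `stub_smearedMomentBound : SmearedMomentBound` — OnsetTautology's smeared ceiling currency BY NAME.
* `stub_cofinalEngineBS` — SOFT: `CofinalSubOnsetFloorsS → SubOnsetTwoPointCeilingsOnset → SmearedMomentBound → leaf`; the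
  sub-onset unit selection ENGINE-a′ `CofinalFloorsS → CofinalSubOnsetFloorsS` is PROVED (`sSup` case split per `k` +
  the landed `onsetVanishes_proof`).
* composition `HypercubicOSDataFromInfiniteVolume_of_cofinalFRS` (sorry-free) concludes the leaf BY NAME.

REV 2 (2026-08-29, same day as REV 1 998b8748; mirrors LINE «CofinalWindows» REV 3 = idea-crit-9 #90/#90a P1′/P3): N2 derived
from the typed `SummedResponseBoundS` (MVT, proved); engine split at the typed `CofinalSubOnsetFloorsS` with ENGINE-a′ proved.

REV 3 (2026-08-29; answers idea-crit-9 #90 P4 option (ii) IN THE KERNEL): the E stub is now E_AM `AxisMirrorCeilingOnset` =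
item 26791 `SquareRootCeilings.AxisMirrorCeiling` minus its `∀β` floor antecedent (on-axis mirror pairs only), and
E `SubOnsetTwoPointCeilingsOnset` is DERIVED from it by the landed reflection-positivity Cauchy–Schwarz
(`MirrorDomination.abs_cov_le_of_axisMirror`; `subOnsetTwoPointCeilingsOnset_of_axisMirrorOnset`, sorry-free).

REV 4 (2026-08-29; SELF-AUDIT CORRECTION of N2/N2′): the free-standing currencies `CouplingEquicontinuityS` / `SummedResponseBoundS` of the
earlier revisions quantified over ALL Schwartz test pairs (including overlapping supports, where the contact terms of
the bare `Q2` scale like `s⁻⁴` with a non-vanishing coupling derivative) and over ALL units `s ∈ (0,1]` (including the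
infrared regime `s ≪ a(β)`): MIS-TYPED (false as stated for overlapping pairs).  They are REPLACED by the window-local,
floor-data-conditioned `WindowLipschitz` / `WindowResponseBound` (N1's disjoint tests, N1's unit `a(c₀)`, couplings inside the window) —
exactly what the selection `cofinalFloorsS_of_windows` consumes; the selection and the MVT lemma are re-proved for them.

REV 5 (2026-08-29; dedup, idea-crit-9 #90b/#91a (b)): N2/N2′ are now ONE statement `WindowLipschitz` / `WindowResponseBound`
(Schwartz `f`, compactly supported `v, g, h`, pairwise disjoint) with the SAME body in both g18 line files — this line instantiates it
with `(f, g, h) := (f, θv, v)`; one landing of the body discharges both lines' N2′ stubs by `exact`.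

REV 6 (2026-08-29; idea-crit-9 #90c∕#91b (3b) price P2, form β — «own or cut the zero-test instance»): E_AM and E are
RE-TYPED ONSET-CONDITIONED pointwise in `(β, s)` — `AxisMirrorCeilingOnset` / `SubOnsetTwoPointCeilingsOnset` carry the
hypotheses (a) «`s` carries both floors of level `ε` along a strictly increasing torus sequence» and (b) «no unit in
`[2s,1]` carries the `∀L`-floors» (exactly clauses (a), (b) of `CofinalSubOnsetFloorsS`), replacing the deleted `∀β`
antecedent of 26791 / 26671: the zero-test ∕ floor-less instances (which made the REV 4–6 antecedent-free forms
contain the test-free all-distance `t⁻⁸` law) are now VACUOUS, «below onset» is meaningful again, and BOTH items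
follow BY NAME (`axisMirrorCeiling_of_onset`, `subOnsetTwoPointCeilings_of_onset`: near-top `∀L`-floor unit,
`exists_onset_unit`).  ENGINE-b consumes the conditioned E (it instantiates at `(β_k, w_k)` anyway).  The REV 4–6
names `…Free` are superseded by `…Onset` throughout (history paragraphs above use the new names).

HONEST LABEL: a SKELETON with proved bookkeeping/real-analysis lemmas; it proves no stub, no crux, no rung, no leaf
and no summit; nothing about Bałaban's RG or Clay is asserted; the Yang–Mills mass gap is NOT proved.
-/

set_option autoImplicit false

noncomputable section

open scoped BigOperators
open MeasureTheory Filter Topology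
open Literature.MathematicalPhysics.QuantumFieldTheory Literature.MathematicalPhysics.QuantumLattice
open Literature.Probability.LatticeModels
open Summit.QuantumFields.YangMills.Cruxes.OSLegsFromFemtoAndGap.DlrCollarTransfer
open Summit.QuantumFields.YangMills.Cruxes.AtomicCalibrationR.MirrorCalibration (SmearedMomentBound)
open Summit.QuantumFields.YangMills.Theses.ForcedResponseSkewness (ResponseLocalisation RunningCouplingCeiling
  FloorWithScalingLimits)
open Summit.QuantumFields.YangMills.Theorems.ForcedResponseSkewness (exists_window exists_level_and_slope_mul_le
  relLocalisation_of_signedCollar_far)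

namespace Summit.QuantumFields.YangMills.Cruxes.HypercubicOSDataFromInfiniteVolume.CofinalFRS

/-! ## §1 The typed currencies -/

/-- **`FloorRatioFar` — FRS's residual `FloorWithScalingLimits` (stmt-QuantumFields-24873) with its two SCALING-LIMIT
clauses deleted**, everything else character for character: for every compact simple `G` there are `r`, an antitone
unit `a → 0⁺` with ratio law `a(c)/a(c+t) → e^{κt}` (`κ > 0`), a base point `p` (`p₀ > 0`) and ONE level `ε > 0` such that
every radius `0 < ρ < p₀` carries a real Schwartz `v` with `tsupport v ⊆ closedBall p ρ ∩ {y₀ > 0}`, `∫|v| ≤ 1`,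
`tsupport θv` disjoint from `tsupport v`, (a) the clause-(i) floor `ε ≤ Q2_(β,L,aβ)(θv,v)` on all large tori, and
(c) the far-field response ceiling.  No `Φ₂`, no `Φ₃^f`. -/
def FloorRatioFar : Prop :=
  ∀ (G : Type) [Group G] [TopologicalSpace G] [IsTopologicalGroup G] [CompactSpace G], IsCompactSimpleLieGroup G →
    letI : MeasurableSpace G := borel G
    haveI : BorelSpace G := ⟨rfl⟩
    ∃ (r : LatticeRep G) (a : ℝ → ℝ) (κ : ℝ) (p : EuclideanSpace ℝ (Fin 4)) (ε : ℝ),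
      (∀ β, 0 < a β) ∧ Tendsto a atTop (nhds 0) ∧ Antitone a ∧ 0 < κ ∧
      (∀ t : ℝ, 0 ≤ t → Tendsto (fun c : ℝ => a c / a (c + t)) atTop (nhds (Real.exp (κ * t)))) ∧
      0 < p 0 ∧ 0 < ε ∧
      ∀ ρ : ℝ, 0 < ρ → ρ < p 0 → ∃ (v : SchwartzMap (EuclideanSpace ℝ (Fin 4)) ℝ),
        tsupport v ⊆ Metric.closedBall p ρ ∧ tsupport v ⊆ {y : EuclideanSpace ℝ (Fin 4) | 0 < y 0} ∧
        (∫ y, |v y|) ≤ 1 ∧ Disjoint (tsupport (thetaTest 4 v)) (tsupport v) ∧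
        (∃ β₅ Λ₅ : ℝ, ∀ β : ℝ, β₅ ≤ β → ∀ L : ℕ, Λ₅ ≤ a β * L → ε ≤ Q2 G r β L (a β) (thetaTest 4 v) v) ∧
        (∀ η : ℝ, 0 < η → ∀ Λ : ℝ, 1 ≤ Λ → ∃ D : ℝ, 0 < D ∧ ∃ β₆ Λ₆ : ℝ, ∀ β : ℝ, β₆ ≤ β → ∀ L : ℕ,
          Λ₆ ≤ a β * L → ∀ l : ℝ, l ∈ Set.Icc 1 Λ →
            (∑ x ∈ box 4 L, (if D < ‖(l * a β) • siteToE x‖ then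
              |∑ y ∈ box 4 L, ∑ z ∈ box 4 L, (thetaTest 4 v) ((l * a β) • siteToE y) * v ((l * a β) • siteToE z) *
                torusK3 G r β L x y z| else 0)) ≤
              η * (1 + |deriv (fun c : ℝ => Q2 G r c L (l * a β) (thetaTest 4 v) v) β|))

/-- **`WindowFloorsS` — window floors with a Schwartz three-point source** (the per-window, per-torus, fixed-unit
output of FRS's window step).  For every SU(2)-class `G`: `r`, a unit `a > 0` with `a → 0`, a compactly supported
positive-time `v`, a Schwartz `f` with `f, θv, v` pairwise disjointly supported, `ε > 0`, `T₀ ≥ 0` such that in every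
window `[c₀, c₀+T₀]` (`c₀ ≥ β₅`) and on every odd torus `2L+1` with `a(c₀)·L ≥ Λ₅` some coupling `c` carries BOTH
floors in the unit `a(c₀)`: `ε ≤ Q2_(c,L,a c₀)(θv,v)` and `ε ≤ |Q3_(c,L,a c₀)(f,θv,v)|`. -/
def WindowFloorsS : Prop :=
  ∀ (G : Type) [Group G] [TopologicalSpace G] [IsTopologicalGroup G] [CompactSpace G],
    IsCompactSimpleLieGroup G → Nonempty (G ≃ₜ* Matrix.specialUnitaryGroup (Fin 2) ℂ) →
    letI : MeasurableSpace G := borel G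
    haveI : BorelSpace G := ⟨rfl⟩
    ∃ (r : LatticeRep G) (a : ℝ → ℝ) (v f : SchwartzMap (EuclideanSpace ℝ (Fin 4)) ℝ) (ε T₀ Λ₅ β₅ : ℝ),
      HasCompactSupport (v : EuclideanSpace ℝ (Fin 4) → ℝ) ∧ tsupport v ⊆ {y : EuclideanSpace ℝ (Fin 4) | 0 < y 0} ∧
      Disjoint (tsupport f) (tsupport v) ∧ Disjoint (tsupport f) (tsupport (thetaTest 4 v)) ∧
      Disjoint (tsupport (thetaTest 4 v)) (tsupport v) ∧
      (∀ β, 0 < a β) ∧ Tendsto a atTop (nhds 0) ∧ 0 < ε ∧ 0 ≤ T₀ ∧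
      ∀ c₀ : ℝ, β₅ ≤ c₀ → ∀ L : ℕ, Λ₅ ≤ a c₀ * L → ∃ c : ℝ, c₀ ≤ c ∧ c ≤ c₀ + T₀ ∧
        ε ≤ Q2 G r c L (a c₀) (thetaTest 4 v) v ∧ ε ≤ |Q3 G r c L (a c₀) f (thetaTest 4 v) v|

/-- **N2 `WindowLipschitz` — window-local Lipschitz continuity in the coupling AT THE FLOORS' UNIT (CORRECTED currency; ONE
statement shared character for character by both g18 lines).**  WHEREVER window floors hold — for any data
`(r, a, v, f, g, h, ε, T₀, Λ₅, β₅)` (Schwartz tests; `v, g, h` compactly supported, `v` positive-time; `f, g, h` pairwise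
disjointly supported; some `c ∈ [c₀, c₀+T₀]` carries the two-point floor of `(θv, v)` and the three-point floor of
`(f, g, h)` at the unit `a(c₀)` on every torus `a(c₀)·L ≥ Λ₅`, for every window `c₀ ≥ β₅`) — the smeared torus two- and
three-point functions at that unit are `K`-Lipschitz in the coupling ACROSS THE WINDOW `[c₀, c₀+T₀]`, with ONE `K` for
all windows `c₀ ≥ β₆` and all tori `a(c₀)·L ≥ Λ₆`.  (The free-standing forms of the earlier revisions, quantified over
ALL test pairs — overlapping supports included, where the contact terms of the bare `Q2` scale like `s⁻⁴` with a
non-vanishing coupling derivative — and over ALL units `s ∈ (0,1]`, were MIS-TYPED and are withdrawn.  This form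
quantifies exactly what the selection consumes: the floors' disjoint tests, the floors' unit, couplings in the window.) -/
def WindowLipschitz : Prop :=
  ∀ (G : Type) [Group G] [TopologicalSpace G] [IsTopologicalGroup G] [CompactSpace G],
    IsCompactSimpleLieGroup G → Nonempty (G ≃ₜ* Matrix.specialUnitaryGroup (Fin 2) ℂ) →
    letI : MeasurableSpace G := borel G
    haveI : BorelSpace G := ⟨rfl⟩
    ∀ (r : LatticeRep G) (a : ℝ → ℝ) (v f g h : SchwartzMap (EuclideanSpace ℝ (Fin 4)) ℝ) (ε T₀ Λ₅ β₅ : ℝ),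
      HasCompactSupport (v : EuclideanSpace ℝ (Fin 4) → ℝ) → HasCompactSupport (g : EuclideanSpace ℝ (Fin 4) → ℝ) →
      HasCompactSupport (h : EuclideanSpace ℝ (Fin 4) → ℝ) → tsupport v ⊆ {y : EuclideanSpace ℝ (Fin 4) | 0 < y 0} →
      Disjoint (tsupport f) (tsupport g) → Disjoint (tsupport g) (tsupport h) → Disjoint (tsupport f) (tsupport h) →
      (∀ β, 0 < a β) → Tendsto a atTop (nhds 0) → 0 < ε → 0 ≤ T₀ →
      (∀ c₀ : ℝ, β₅ ≤ c₀ → ∀ L : ℕ, Λ₅ ≤ a c₀ * L → ∃ c : ℝ, c₀ ≤ c ∧ c ≤ c₀ + T₀ ∧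
        ε ≤ Q2 G r c L (a c₀) (thetaTest 4 v) v ∧ ε ≤ |Q3 G r c L (a c₀) f g h|) →
      ∃ (K Λ₆ β₆ : ℝ), 0 ≤ K ∧ ∀ c₀ : ℝ, β₆ ≤ c₀ → ∀ β β' : ℝ,
        c₀ ≤ β → β ≤ c₀ + T₀ → c₀ ≤ β' → β' ≤ c₀ + T₀ → ∀ L : ℕ, Λ₆ ≤ a c₀ * L →
          |Q2 G r β L (a c₀) (thetaTest 4 v) v - Q2 G r β' L (a c₀) (thetaTest 4 v) v| ≤ K * |β - β'| ∧
          |Q3 G r β L (a c₀) f g h - Q3 G r β' L (a c₀) f g h| ≤ K * |β - β'|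

/-- **N2′ `WindowResponseBound` — the Feynman–Hellmann form of N2 (the registered stub's statement; ONE statement shared
character for character by both g18 lines, so that one landing discharges both).**  Same antecedent; conclusion: ONE
constant `K` bounding the coupling DERIVATIVE of `c ↦ Q2_(c,L,a c₀)(θv,v)` and `c ↦ Q3_(c,L,a c₀)(f,g,h)` at every
coupling of every window `[c₀, c₀+T₀]`, `c₀ ≥ β₆`, on every torus `a(c₀)·L ≥ Λ₆` (`HasDerivAt` form; by the tree's sum
rule `hasDerivAt_Q2_coupling` the derivative IS the smeared third cumulant with the total action — a RESPONSE CEILING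
at the floors' unit with one torus-summed leg; E-wall-adjacent upper-bound class, n = 2, 3, derivative form). -/
def WindowResponseBound : Prop :=
  ∀ (G : Type) [Group G] [TopologicalSpace G] [IsTopologicalGroup G] [CompactSpace G],
    IsCompactSimpleLieGroup G → Nonempty (G ≃ₜ* Matrix.specialUnitaryGroup (Fin 2) ℂ) →
    letI : MeasurableSpace G := borel G
    haveI : BorelSpace G := ⟨rfl⟩
    ∀ (r : LatticeRep G) (a : ℝ → ℝ) (v f g h : SchwartzMap (EuclideanSpace ℝ (Fin 4)) ℝ) (ε T₀ Λ₅ β₅ : ℝ),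
      HasCompactSupport (v : EuclideanSpace ℝ (Fin 4) → ℝ) → HasCompactSupport (g : EuclideanSpace ℝ (Fin 4) → ℝ) →
      HasCompactSupport (h : EuclideanSpace ℝ (Fin 4) → ℝ) → tsupport v ⊆ {y : EuclideanSpace ℝ (Fin 4) | 0 < y 0} →
      Disjoint (tsupport f) (tsupport g) → Disjoint (tsupport g) (tsupport h) → Disjoint (tsupport f) (tsupport h) →
      (∀ β, 0 < a β) → Tendsto a atTop (nhds 0) → 0 < ε → 0 ≤ T₀ →
      (∀ c₀ : ℝ, β₅ ≤ c₀ → ∀ L : ℕ, Λ₅ ≤ a c₀ * L → ∃ c : ℝ, c₀ ≤ c ∧ c ≤ c₀ + T₀ ∧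
        ε ≤ Q2 G r c L (a c₀) (thetaTest 4 v) v ∧ ε ≤ |Q3 G r c L (a c₀) f g h|) →
      ∃ (K Λ₆ β₆ : ℝ), 0 ≤ K ∧ ∀ c₀ : ℝ, β₆ ≤ c₀ → ∀ β : ℝ, c₀ ≤ β → β ≤ c₀ + T₀ →
        ∀ L : ℕ, Λ₆ ≤ a c₀ * L →
          (∃ D : ℝ, HasDerivAt (fun c : ℝ => Q2 G r c L (a c₀) (thetaTest 4 v) v) D β ∧ |D| ≤ K) ∧
          (∃ D : ℝ, HasDerivAt (fun c : ℝ => Q3 G r c L (a c₀) f g h) D β ∧ |D| ≤ K)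

/-- Mean-value inequality on `[lo, hi]`: a derivative bound `K` at every point gives the Lipschitz bound `K`. [folklore] -/
private theorem abs_sub_le_of_hasDerivAt_bound_Icc (q : ℝ → ℝ) (K lo hi : ℝ)
    (hq : ∀ β : ℝ, lo ≤ β → β ≤ hi → ∃ D : ℝ, HasDerivAt q D β ∧ |D| ≤ K) (β β' : ℝ)
    (hβ1 : lo ≤ β) (hβ2 : β ≤ hi) (hβ'1 : lo ≤ β') (hβ'2 : β' ≤ hi) :
    |q β - q β'| ≤ K * |β - β'| := by
  have hderiv : ∀ x ∈ Set.Icc lo hi, HasDerivWithinAt q (deriv q x) (Set.Icc lo hi) x := by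
    intro x hx
    obtain ⟨D, hD, -⟩ := hq x hx.1 hx.2
    exact (hD.differentiableAt.hasDerivAt).hasDerivWithinAt
  have hbound : ∀ x ∈ Set.Icc lo hi, ‖deriv q x‖ ≤ K := by
    intro x hx
    obtain ⟨D, hD, hDK⟩ := hq x hx.1 hx.2
    rw [hD.deriv, Real.norm_eq_abs]
    exact hDK
  have h := (convex_Icc lo hi).norm_image_sub_le_of_norm_hasDerivWithin_le hderiv hbound ⟨hβ'1, hβ'2⟩ ⟨hβ1, hβ2⟩
  simpa [Real.norm_eq_abs] using h

/-- **N2′ ⟹ N2 (kernel-checked):** the window response bound gives window Lipschitz continuity, same constant and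
thresholds, by the mean-value inequality on `[c₀, c₀+T₀]`. -/
theorem windowLipschitz_of_responseBound (hN : WindowResponseBound) : WindowLipschitz := by
  intro G _ _ _ _ hG hcl
  letI : MeasurableSpace G := borel G
  haveI : BorelSpace G := ⟨rfl⟩
  intro r a v f g h ε T₀ Λ₅ β₅ hvK hgK hhK hv hfg hgh hfh hapos ha0 hε hT₀ hW
  obtain ⟨K, Λ₆, β₆, hK, hD⟩ := hN G hG hcl r a v f g h ε T₀ Λ₅ β₅ hvK hgK hhK hv hfg hgh hfh hapos ha0 hε hT₀ hW
  refine ⟨K, Λ₆, β₆, hK, fun c₀ hc₀ β β' h1 h2 h1' h2' L hL => ⟨?_, ?_⟩⟩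
  · exact abs_sub_le_of_hasDerivAt_bound_Icc (fun c : ℝ => Q2 G r c L (a c₀) (thetaTest 4 v) v) K c₀ (c₀ + T₀)
      (fun b hb1 hb2 => (hD c₀ hc₀ b hb1 hb2 L hL).1) β β' h1 h2 h1' h2'
  · exact abs_sub_le_of_hasDerivAt_bound_Icc (fun c : ℝ => Q3 G r c L (a c₀) f g h) K c₀ (c₀ + T₀)
      (fun b hb1 hb2 => (hD c₀ hc₀ b hb1 hb2 L hL).2) β β' h1 h2 h1' h2'

/-- **`CofinalFloorsS` — the cofinal joint-floor currency (Schwartz source).**  For every SU(2)-class `G`: `r`,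
couplings `β_k → ∞`, units `u_k ∈ (0,1]` with `u_k → 0`, a compactly supported positive-time `v`, a Schwartz `f`
(`f, θv, v` pairwise disjointly supported), `ε > 0`, and for every `k` a strictly increasing odd-torus sequence along
which BOTH floors hold at `(β_k, u_k)`.  This is what the leaf's `oddTorusLimitPoints`-states consume. -/
def CofinalFloorsS : Prop :=
  ∀ (G : Type) [Group G] [TopologicalSpace G] [IsTopologicalGroup G] [CompactSpace G],
    IsCompactSimpleLieGroup G → Nonempty (G ≃ₜ* Matrix.specialUnitaryGroup (Fin 2) ℂ) →
    letI : MeasurableSpace G := borel G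
    haveI : BorelSpace G := ⟨rfl⟩
    ∃ (r : LatticeRep G) (βk u : ℕ → ℝ) (v f : SchwartzMap (EuclideanSpace ℝ (Fin 4)) ℝ) (ε : ℝ),
      HasCompactSupport (v : EuclideanSpace ℝ (Fin 4) → ℝ) ∧ tsupport v ⊆ {y : EuclideanSpace ℝ (Fin 4) | 0 < y 0} ∧
      Disjoint (tsupport f) (tsupport v) ∧ Disjoint (tsupport f) (tsupport (thetaTest 4 v)) ∧
      Disjoint (tsupport (thetaTest 4 v)) (tsupport v) ∧
      (∀ k, 0 < u k) ∧ (∀ k, u k ≤ 1) ∧ Tendsto u atTop (nhds 0) ∧ Tendsto βk atTop atTop ∧ 0 < ε ∧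
      ∀ k, ∃ S : ℕ → ℕ, StrictMono S ∧ ∀ j,
        ε ≤ Q2 G r (βk k) (S j) (u k) (thetaTest 4 v) v ∧ ε ≤ |Q3 G r (βk k) (S j) (u k) f (thetaTest 4 v) v|

/-- **E `SubOnsetTwoPointCeilingsOnset` — item 26671 `SquareRootCeilings.SubOnsetTwoPointCeilings` ONSET-CONDITIONED
pointwise in `(β, s)`** (REV 7∕6; answers idea-crit-9 #90c (3b) price P2, form β).  The `∀β` onset-floor antecedent of
26671 is replaced by two hypotheses AT `(β, s)`: (a) the unit `s` carries BOTH floors of level `ε` along a strictly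
increasing odd-torus sequence, (b) no unit `s' ∈ [2s, 1]` carries the two `∀L`-floors of level `ε` (threshold `Λ₅`) —
exactly clauses (a), (b) of `CofinalSubOnsetFloorsK` at `(β_k, w_k)`; conclusion verbatim (`|Cov_T(P_q(x), P_q'(y))|
≤ (C/R⁴)²` for cyclically `(2R+4)`-separated pairs, `R s ≤ ℓ₄`, `4R+8 ≤ L`).  The zero-test and floor-less instances
are VACUOUS (no unit carries floors), so the statement owes ceilings ONLY at onset units of floor-carrying couplings,
`R ≤ ℓ₄/s` = the hyperscaling regime below the tests' onset — «sub-onset» keeps its meaning.  `⇒ 26671` BY NAME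
(`subOnsetTwoPointCeilings_of_onset`, a supremum argument over the `∀L`-floor units). -/
def SubOnsetTwoPointCeilingsOnset : Prop :=
  ∀ (G : Type) [Group G] [TopologicalSpace G] [IsTopologicalGroup G] [CompactSpace G],
    IsCompactSimpleLieGroup G → Nonempty (G ≃ₜ* Matrix.specialUnitaryGroup (Fin 2) ℂ) →
    letI : MeasurableSpace G := borel G
    haveI : BorelSpace G := ⟨rfl⟩
    ∀ (r : LatticeRep G) (v f g h : SchwartzMap (EuclideanSpace ℝ (Fin 4)) ℝ) (Λ₅ : ℝ), ∃ ε₀ : ℝ, 0 < ε₀ ∧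
      ∀ ε : ℝ, 0 < ε → ε ≤ ε₀ → ∃ (C ℓ₄ β₄ : ℝ), 0 < ℓ₄ ∧ 0 ≤ C ∧ ∀ β : ℝ, β₄ ≤ β → ∀ s : ℝ, 0 < s → s ≤ 1 →
        (∃ S : ℕ → ℕ, StrictMono S ∧ ∀ j,
            ε ≤ Q2 G r β (S j) s (thetaTest 4 v) v ∧ ε ≤ |Q3 G r β (S j) s f g h|) →
        (∀ s' : ℝ, 2 * s ≤ s' → s' ≤ 1 →
          ¬ ((∀ L : ℕ, Λ₅ ≤ s' * L → ε ≤ Q2 G r β L s' (thetaTest 4 v) v) ∧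
             (∀ L : ℕ, Λ₅ ≤ s' * L → ε ≤ |Q3 G r β L s' f g h|))) →
        ∀ (L : ℕ) (q q' : Fin 4 × Fin 4) (x y : Fin 4 → ℤ) (R : ℕ), q.1 < q.2 → q'.1 < q'.2 → 1 ≤ R →
          (R : ℝ) * s ≤ ℓ₄ → 4 * R + 8 ≤ L →
          (∃ k : Fin 4, (2 * (R : ℤ) + 4) ≤ |((((x k - y k : ℤ) : ZMod (2 * L + 1))).valMinAbs : ℤ)|) →
          |torusE G r β L (fun U => (plane G r q x U - torusE G r β L (plane G r q x)) *
            (plane G r q' y U - torusE G r β L (plane G r q' y)))| ≤ (C / (R : ℝ) ^ 4) ^ 2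

/-- **E_AM `AxisMirrorCeilingOnset`** — item 26791 `SquareRootCeilings.AxisMirrorCeiling` ONSET-CONDITIONED pointwise in
`(β, s)` (same hypotheses (a), (b) as E; conclusion verbatim: the ON-AXIS same-orientation mirror-pair plaquette
covariance at axis separation `t ∈ [2R+2, L]`, `R·s ≤ ℓ₄`, `4R+8 ≤ L`, is `≤ (C/R⁴)²` — a Hausdorff-moment ceiling on
one plaquette's spectral measure, the open E-wall content of route SquareRootCeilings, on-axis, owed only at onset
units of floor-carrying couplings).  `⇒ 26791` BY NAME (`axisMirrorCeiling_of_onset`); `⇒ E` by the LANDED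
reflection-positivity Cauchy–Schwarz `MirrorDomination.abs_cov_le_of_axisMirror` (`subOnsetTwoPointCeilingsOnset_of_axisMirrorOnset`). -/
def AxisMirrorCeilingOnset : Prop :=
  ∀ (G : Type) [Group G] [TopologicalSpace G] [IsTopologicalGroup G] [CompactSpace G],
    IsCompactSimpleLieGroup G → Nonempty (G ≃ₜ* Matrix.specialUnitaryGroup (Fin 2) ℂ) →
    letI : MeasurableSpace G := borel G
    haveI : BorelSpace G := ⟨rfl⟩
    ∀ (r : LatticeRep G) (v f g h : SchwartzMap (EuclideanSpace ℝ (Fin 4)) ℝ) (Λ₅ : ℝ), ∃ ε₀ : ℝ, 0 < ε₀ ∧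
      ∀ ε : ℝ, 0 < ε → ε ≤ ε₀ → ∃ (C ℓ₄ β₄ : ℝ), 0 < ℓ₄ ∧ 0 ≤ C ∧ ∀ β : ℝ, β₄ ≤ β → ∀ s : ℝ, 0 < s → s ≤ 1 →
        (∃ S : ℕ → ℕ, StrictMono S ∧ ∀ j,
            ε ≤ Q2 G r β (S j) s (thetaTest 4 v) v ∧ ε ≤ |Q3 G r β (S j) s f g h|) →
        (∀ s' : ℝ, 2 * s ≤ s' → s' ≤ 1 →
          ¬ ((∀ L : ℕ, Λ₅ ≤ s' * L → ε ≤ Q2 G r β L s' (thetaTest 4 v) v) ∧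
             (∀ L : ℕ, Λ₅ ≤ s' * L → ε ≤ |Q3 G r β L s' f g h|))) →
        ∀ (L : ℕ) (q : Fin 4 × Fin 4) (k : Fin 4) (R t : ℕ), q.1 < q.2 → 1 ≤ R → (R : ℝ) * s ≤ ℓ₄ →
          4 * R + 8 ≤ L → 2 * R + 2 ≤ t → t ≤ L →
          |torusE G r β L (fun U => (plane G r q (fun i => if i = k then (t : ℤ) else 0) U -
              torusE G r β L (plane G r q (fun i => if i = k then (t : ℤ) else 0))) *
            (plane G r q (fun _ => 0) U - torusE G r β L (plane G r q (fun _ => 0))))| ≤ (C / (R : ℝ) ^ 4) ^ 2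

/-- **E_AM ⟹ E (kernel-checked port of the landed `MirrorDomination`, stmt 26792):** the on-axis mirror-pair ceiling
dominates every cyclically `(2R+4)`-separated plaquette pair by reflection-positivity Cauchy–Schwarz
(`MirrorDomination.abs_cov_le_of_axisMirror`, pointwise in `(β, s, L)`; reflection positivity used at `β ≥ 0`). -/
theorem subOnsetTwoPointCeilingsOnset_of_axisMirrorOnset (hE : AxisMirrorCeilingOnset) :
    SubOnsetTwoPointCeilingsOnset := by
  intro G _ _ _ _ hG hcl
  letI : MeasurableSpace G := borel G
  haveI : BorelSpace G := ⟨rfl⟩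
  intro r v f g h Λ₅
  obtain ⟨ε₀, hε₀, hA1⟩ := hE G hG hcl r v f g h Λ₅
  refine ⟨ε₀, hε₀, fun ε hε hεε => ?_⟩
  obtain ⟨C, ℓ₄, β₄, hℓ₄, hC, hA2⟩ := hA1 ε hε hεε
  refine ⟨C, ℓ₄, max β₄ 0, hℓ₄, hC, fun β hβ s hs hs1 hfl hsub L q q' x y R hq hq' hR hRs hRL hsep => ?_⟩
  have hβ4 : β₄ ≤ β := le_trans (le_max_left _ _) hβ
  have hβ0 : (0 : ℝ) ≤ β := le_trans (le_max_right _ _) hβ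
  obtain ⟨k, hk⟩ := hsep
  exact Summit.QuantumFields.YangMills.Theorems.MirrorDomination.abs_cov_le_of_axisMirror G r hβ0 hR hRL
    (fun q₁ t hq₁ ht htL => hA2 β hβ4 s hs hs1 hfl hsub L q₁ 0 R t hq₁ hR hRs hRL ht htL) hq hq' x y k hk

/-! ## §2 Proved: the residual is weaker; the window step on every torus; FRS ⇒ window floors; selection -/

/-- `FloorWithScalingLimits → FloorRatioFar`: delete the two limit clauses. [bookkeeping; the wuc direction] -/
theorem floorRatioFar_of_floorWithScalingLimits (h : FloorWithScalingLimits) : FloorRatioFar := by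
  intro G _ _ _ _ hG
  letI : MeasurableSpace G := borel G
  haveI : BorelSpace G := ⟨rfl⟩
  obtain ⟨r, a, κ, p, ε, hapos, hlim, hanti, hκ, hratio, hp0, hε, hfam⟩ := h G hG
  refine ⟨r, a, κ, p, ε, hapos, hlim, hanti, hκ, hratio, hp0, hε, fun ρ hρ hρp => ?_⟩
  obtain ⟨v, Φ₂, hvball, hvsupp, hvL1, hdisj, hfloor, -, -, hfar⟩ := hfam ρ hρ hρp
  exact ⟨v, hvball, hvsupp, hvL1, hdisj, hfloor, hfar⟩

section Window

variable (G : Type) [Group G] [TopologicalSpace G] [IsTopologicalGroup G] [CompactSpace G]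
  [MeasurableSpace G] [BorelSpace G] (r : LatticeRep G) (a : ℝ → ℝ)

/-- **The window step on EVERY large torus** (port of FRS's `lowerBounds_of_floor_ceiling_localisation_rel`, Steps 1–5,
with the torus left free and NO scaling limits).  From the floor `ε` at the unit, the ceiling `C/log²Λ ≤ ε/4` on
`l ∈ [Λ, 2Λ]`, the relative localisation on `l ∈ [1, 2Λ]` (`η ≤ 1/2`, `η ≤ ε/(8T₀)`), an antitone unit with ratio law
and the window `e^{κT₀} = 3Λ/2`: thresholds `β₇, Λ₇` such that for every `c₀ ≥ β₇` and every torus with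
`a(c₀)·L ≥ Λ₇` some `c ∈ [c₀, c₀+T₀]` has `Q2_(c,L,a c₀)(θv,v) ≥ ε/2` and `|Q3_(c,L,a c₀)(f,θv,v)| ≥ ε/(8T₀)`. [folklore] -/
theorem windowFloors_of_floor_ceiling_localisation
    (v f : SchwartzMap (EuclideanSpace ℝ (Fin 4)) ℝ) (κ ε β₅ Λ₅ C Λ T₀ η : ℝ)
    (hapos : ∀ β, 0 < a β) (hanti : Antitone a)
    (hratio : ∀ t : ℝ, 0 ≤ t → Tendsto (fun c : ℝ => a c / a (c + t)) atTop (nhds (Real.exp (κ * t))))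
    (hε : 0 < ε) (hΛ2 : 2 ≤ Λ) (hT₀1 : 1 ≤ T₀) (hexp : Real.exp (κ * T₀) = 3 * Λ / 2)
    (hceil : C / Real.log Λ ^ 2 ≤ ε / 4) (hη1 : η ≤ 1 / 2) (hη2 : η ≤ ε / (8 * T₀))
    (hfloor : ∀ β : ℝ, β₅ ≤ β → ∀ L : ℕ, Λ₅ ≤ a β * L → ε ≤ Q2 G r β L (a β) (thetaTest 4 v) v)
    (hC : ∃ β₆ Λ₆ : ℝ, ∀ β : ℝ, β₆ ≤ β → ∀ L : ℕ, Λ₆ ≤ a β * L →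
      ∀ l : ℝ, l ∈ Set.Icc Λ (2 * Λ) → Q2 G r β L (l * a β) (thetaTest 4 v) v ≤ C / Real.log Λ ^ 2)
    (hloc : ∃ β₆ Λ₆ : ℝ, ∀ β : ℝ, β₆ ≤ β → ∀ L : ℕ, Λ₆ ≤ a β * L → ∀ l : ℝ, l ∈ Set.Icc 1 (2 * Λ) →
      |deriv (fun c : ℝ => Q2 G r c L (l * a β) (thetaTest 4 v) v) β - Q3 G r β L (l * a β) f (thetaTest 4 v) v| ≤
        η * (1 + |deriv (fun c : ℝ => Q2 G r c L (l * a β) (thetaTest 4 v) v) β|)) :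
    ∃ β₇ Λ₇ : ℝ, ∀ c₀ : ℝ, β₇ ≤ c₀ → ∀ L : ℕ, Λ₇ ≤ a c₀ * L → ∃ c : ℝ, c₀ ≤ c ∧ c ≤ c₀ + T₀ ∧
      ε / 2 ≤ Q2 G r c L (a c₀) (thetaTest 4 v) v ∧ ε / (8 * T₀) ≤ |Q3 G r c L (a c₀) f (thetaTest 4 v) v| := by
  have hT₀ : 0 < T₀ := by linarith
  have hΛpos : 0 < Λ := by linarith
  have h2Λpos : (0 : ℝ) < 2 * Λ := by linarith
  -- Step 1: the thresholds
  obtain ⟨β₂, Λ₂, hceil'⟩ := hC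
  obtain ⟨β₃, Λ₃, hloc'⟩ := hloc
  have hrat : ∀ᶠ c in atTop, a c / a (c + T₀) ∈ Set.Icc Λ (2 * Λ) := by
    have ht := hratio T₀ hT₀.le
    rw [hexp] at ht
    exact ht.eventually (Icc_mem_nhds (by linarith) (by linarith))
  obtain ⟨c₁, hc₁⟩ := Filter.eventually_atTop.1 hrat
  set Λs : ℝ := max (max Λ₅ Λ₂) (max Λ₃ 0) with hΛsdef
  have hΛsΛ₅ : Λ₅ ≤ Λs := le_trans (le_max_left _ _) (le_max_left _ _)
  have hΛsΛ₂ : Λ₂ ≤ Λs := le_trans (le_max_right _ _) (le_max_left _ _)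
  have hΛsΛ₃ : Λ₃ ≤ Λs := le_trans (le_max_left _ _) (le_max_right _ _)
  have hΛs0 : 0 ≤ Λs := le_trans (le_max_right _ _) (le_max_right _ _)
  refine ⟨max (max β₅ β₂) (max β₃ c₁), 2 * Λ * Λs, ?_⟩
  intro c₀ hc₀ L hL
  have hc₀β₅ : β₅ ≤ c₀ := le_trans (le_trans (le_max_left _ _) (le_max_left _ _)) hc₀
  have hc₀β₂ : β₂ ≤ c₀ := le_trans (le_trans (le_max_right _ _) (le_max_left _ _)) hc₀
  have hc₀β₃ : β₃ ≤ c₀ := le_trans (le_trans (le_max_left _ _) (le_max_right _ _)) hc₀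
  have hc₀c₁ : c₁ ≤ c₀ := le_trans (le_trans (le_max_right _ _) (le_max_right _ _)) hc₀
  have haT : 0 < a (c₀ + T₀) := hapos _
  -- Step 2: the torus condition `Λs ≤ a(c₀+T₀)·L` from `2Λ·Λs ≤ a(c₀)·L` and the ratio law `a(c₀) ≤ 2Λ·a(c₀+T₀)`
  have hl₀ : a c₀ / a (c₀ + T₀) ∈ Set.Icc Λ (2 * Λ) := hc₁ c₀ hc₀c₁
  have hac₀le : a c₀ ≤ 2 * Λ * a (c₀ + T₀) := by
    have h := hl₀.2
    rwa [div_le_iff₀ haT] at h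
  have hL' : Λs ≤ a (c₀ + T₀) * L := by
    have h1 : a c₀ * L ≤ 2 * Λ * a (c₀ + T₀) * L := mul_le_mul_of_nonneg_right hac₀le (Nat.cast_nonneg L)
    have h2 : 2 * Λ * Λs ≤ 2 * Λ * (a (c₀ + T₀) * L) := by linarith [mul_assoc (2 * Λ) (a (c₀ + T₀)) (L : ℝ)]
    exact le_of_mul_le_mul_left h2 h2Λpos
  have hmono : ∀ c : ℝ, c ≤ c₀ + T₀ → a (c₀ + T₀) * L ≤ a c * L := fun c hc =>
    mul_le_mul_of_nonneg_right (hanti hc) (Nat.cast_nonneg L)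
  -- Step 3: `q(c) := Q2_{c,L,a(c₀)}(θv,v)`: floor at `c₀`, ceiling at `c₀ + T₀`, MVT
  have hqdiff : Differentiable ℝ (fun c : ℝ => Q2 G r c L (a c₀) (thetaTest 4 v) v) :=
    Summit.QuantumFields.YangMills.Cruxes.NT.SkewResponse.differentiable_Q2_coupling G r L (a c₀)
      (thetaTest 4 v) v
  have hq0 : ε ≤ Q2 G r c₀ L (a c₀) (thetaTest 4 v) v :=
    hfloor c₀ hc₀β₅ L (le_trans hΛsΛ₅ (le_trans hL' (hmono c₀ (by linarith))))
  have hq1 : Q2 G r (c₀ + T₀) L (a c₀) (thetaTest 4 v) v ≤ ε / 4 := by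
    have h := hceil' (c₀ + T₀) (by linarith) L (le_trans hΛsΛ₂ hL') (a c₀ / a (c₀ + T₀)) hl₀
    rw [div_mul_cancel₀ _ haT.ne'] at h
    exact h.trans hceil
  obtain ⟨cs, hcs, hqcs, hdq'⟩ :=
    exists_level_and_slope_mul_le (fun c : ℝ => Q2 G r c L (a c₀) (thetaTest 4 v) v) hqdiff hT₀ hε hq0 hq1
  have hdq : deriv (fun c : ℝ => Q2 G r c L (a c₀) (thetaTest 4 v) v) cs ≤ -(ε / (2 * T₀)) := by
    have h2T : (0 : ℝ) < 2 * T₀ := by positivity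
    have h1 : deriv (fun c : ℝ => Q2 G r c L (a c₀) (thetaTest 4 v) v) cs ≤ -ε / (2 * T₀) := by
      rw [le_div_iff₀ h2T]; linarith
    rwa [neg_div] at h1
  -- Step 4: `λ* := a(c₀)/a(c*) ∈ [1, 2Λ]`
  have hacs : 0 < a cs := hapos cs
  have ha_cs_le : a cs ≤ a c₀ := hanti hcs.1.le
  have ha_cs_ge : a (c₀ + T₀) ≤ a cs := hanti hcs.2.le
  obtain ⟨lam, hlamdef⟩ : ∃ lam : ℝ, lam = a c₀ / a cs := ⟨_, rfl⟩
  have hlam1 : 1 ≤ lam := by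
    rw [hlamdef, le_div_iff₀ hacs, one_mul]
    exact ha_cs_le
  have hlam2 : lam ≤ 2 * Λ := by
    calc lam = a c₀ / a cs := hlamdef
      _ ≤ a c₀ / a (c₀ + T₀) := div_le_div_of_nonneg_left (hapos c₀).le haT ha_cs_ge
      _ ≤ 2 * Λ := hl₀.2
  have hlam_mem : lam ∈ Set.Icc 1 (2 * Λ) := ⟨hlam1, hlam2⟩
  have hlam_mul : lam * a cs = a c₀ := by rw [hlamdef]; exact div_mul_cancel₀ _ hacs.ne'
  have hLcs : a (c₀ + T₀) * L ≤ a cs * L := hmono cs hcs.2.le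
  -- Step 5: relative localisation at `(c*, L, λ*)`: `Q3_{c*,L,a(c₀)}(f,θv,v) ≤ −ε/(8T₀)`
  have hl3 := hloc' cs (by linarith [hcs.1]) L (le_trans hΛsΛ₃ (le_trans hL' hLcs)) lam hlam_mem
  rw [hlam_mul] at hl3
  have hQ3cs : Q3 G r cs L (a c₀) f (thetaTest 4 v) v ≤ -(ε / (8 * T₀)) := by
    set D := deriv (fun c : ℝ => Q2 G r c L (a c₀) (thetaTest 4 v) v) cs with hD
    have hDle : D ≤ -(ε / (2 * T₀)) := hdq
    have hDneg : D < 0 := by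
      have : 0 < ε / (2 * T₀) := by positivity
      linarith
    have habsD : |D| = -D := abs_of_neg hDneg
    have h := (abs_le.1 hl3).1
    rw [habsD] at h
    have hηD : η * (-D) ≤ (1 / 2) * (-D) := mul_le_mul_of_nonneg_right hη1 (by linarith)
    have e : -(ε / (2 * T₀)) / 2 + ε / (8 * T₀) = -(ε / (8 * T₀)) := by field_simp; ring
    nlinarith [hDle, hη2, hηD, e]
  have hpos8 : 0 < ε / (8 * T₀) := by positivity
  refine ⟨cs, hcs.1.le, hcs.2.le, le_of_lt hqcs, ?_⟩
  rw [abs_of_nonpos (by linarith)]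
  linarith

end Window

/-- `θ` preserves compact support (verbatim the tree's `WindowFromNontriviality.hasCompactSupport_thetaTest`, restated
to keep this workfile's imports light). [folklore] -/
private theorem hasCompactSupport_thetaTest' {w : SchwartzMap (EuclideanSpace ℝ (Fin 4)) ℝ}
    (hw : HasCompactSupport (w : EuclideanSpace ℝ (Fin 4) → ℝ)) :
    HasCompactSupport (thetaTest 4 w : EuclideanSpace ℝ (Fin 4) → ℝ) := by
  have heq : (thetaTest 4 w : EuclideanSpace ℝ (Fin 4) → ℝ) =
      (w : EuclideanSpace ℝ (Fin 4) → ℝ) ∘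
        (Literature.MathematicalPhysics.QuantumLattice.timeReflection 4).toHomeomorph := by
    funext y
    simp [thetaTest_apply]
  rw [heq]
  exact hw.comp_homeomorph _

/-- **FRS ⇒ window floors (kernel-checked).**  The choices of FRS's `assembly_proof` (pinning member at radius `p₀/2`,
ceiling constant `C`, window `(Λ, T₀)` from `exists_window`, tolerance `η = min(1/2, ε/(8T₀))`, contact radius `ρ`,
family member `v` at radius `min ρ (p₀/2)`, the SIGNED-collar crux and the residual's far-field clause glued by
`relLocalisation_of_signedCollar_far` into the relative localisation with a Schwartz source `f`), followed by the
window step on every torus.  No scaling limit is used. -/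
theorem windowFloorsS_of_FRS (h1 : FloorRatioFar) (h2 : RunningCouplingCeiling) (h3 : ResponseLocalisation) :
    WindowFloorsS := by
  intro G _ _ _ _ hG _hcl
  letI : MeasurableSpace G := borel G
  haveI : BorelSpace G := ⟨rfl⟩
  obtain ⟨r, a, κ, p, ε, hapos, hlim, hanti, hκ, hratio, hp0, hε, hfam⟩ := h1 G hG
  -- a compactly supported floor witness (family member at radius `p₀/2`) for the ceiling's pinning hypothesis
  have hp2 : 0 < p 0 / 2 := half_pos hp0
  have hp2' : p 0 / 2 < p 0 := half_lt_self hp0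
  obtain ⟨v₀, hv₀ball, hv₀supp, -, -, ⟨β₅₀, Λ₅₀, hfloor₀⟩, -⟩ := hfam (p 0 / 2) hp2 hp2'
  have hv₀cpt : HasCompactSupport (v₀ : EuclideanSpace ℝ (Fin 4) → ℝ) :=
    IsCompact.of_isClosed_subset (isCompact_closedBall p (p 0 / 2)) (isClosed_tsupport _) hv₀ball
  have hpin : ∃ (v₀ : SchwartzMap (EuclideanSpace ℝ (Fin 4)) ℝ) (ε β₅ Λ₅ : ℝ), HasCompactSupport v₀ ∧
      tsupport v₀ ⊆ {y : EuclideanSpace ℝ (Fin 4) | 0 < y 0} ∧ 0 < ε ∧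
      ∀ β : ℝ, β₅ ≤ β → ∀ L : ℕ, Λ₅ ≤ a β * L → ε ≤ Q2 G r β L (a β) (thetaTest 4 v₀) v₀ :=
    ⟨v₀, ε, β₅₀, Λ₅₀, hv₀cpt, hv₀supp, hε, hfloor₀⟩
  obtain ⟨C, hC⟩ := h2 G hG r a hapos hlim hpin p (p 0 / 2) hp2 hp2'
  -- the window and the coupling range
  obtain ⟨Λ, T₀, hΛ2, hT₀1, hexp, hceil⟩ := exists_window ε κ C hε hκ
  have hT₀ : 0 < T₀ := by linarith
  have h2Λ1 : (1 : ℝ) ≤ 2 * Λ := by linarith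
  -- tolerance `η := min (1/2) (ε/(8T₀))`; the contact radius at tolerance `η/2` on the window `[1, 2Λ]`
  set η : ℝ := min (1 / 2 : ℝ) (ε / (8 * T₀)) with hηdef
  have hηpos : 0 < η := lt_min one_half_pos (by positivity)
  have hη2 : 0 < η / 2 := half_pos hηpos
  obtain ⟨ρ, hρ, hcon⟩ := h3 G hG r a hapos hlim p hp0 ε hε (η / 2) hη2 (2 * Λ) h2Λ1
  -- the test function of the family at radius `min ρ (p₀/2)`
  have hρ' : 0 < min ρ (p 0 / 2) := lt_min hρ hp2
  have hρ'p : min ρ (p 0 / 2) < p 0 := lt_of_le_of_lt (min_le_right _ _) hp2'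
  obtain ⟨v, hvball, hvsupp, hvL1, hdisj, ⟨β₅, Λ₅, hfloor⟩, hfar⟩ := hfam _ hρ' hρ'p
  have hvballρ : tsupport (v : EuclideanSpace ℝ (Fin 4) → ℝ) ⊆ Metric.closedBall p ρ :=
    hvball.trans (Metric.closedBall_subset_closedBall (min_le_left _ _))
  have hvballρ₀ : tsupport (v : EuclideanSpace ℝ (Fin 4) → ℝ) ⊆ Metric.closedBall p (p 0 / 2) :=
    hvball.trans (Metric.closedBall_subset_closedBall (min_le_right _ _))
  have hvcpt : HasCompactSupport (v : EuclideanSpace ℝ (Fin 4) → ℝ) :=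
    IsCompact.of_isClosed_subset (isCompact_closedBall p ρ) (isClosed_tsupport _) hvballρ
  -- ceiling, collar bound (crux) and far bound (residual) for this `v`; glue to the relative localisation
  have hCv := hC v hvballρ₀ hvL1 Λ hΛ2
  obtain ⟨δ, hδ, χ, hχ1, -, hχR, β₆, Λ₆, hcolχ⟩ := hcon v hvballρ hvsupp hvL1 ⟨β₅, Λ₅, hfloor⟩
  have hfarv := hfar (η / 2) hη2 (2 * Λ) h2Λ1
  obtain ⟨f, hfv, hfθ, hlocv⟩ :=
    relLocalisation_of_signedCollar_far G hG r a v η (2 * Λ) hηpos ⟨δ, hδ, χ, hχ1, hχR, β₆, Λ₆, hcolχ⟩ hfarv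
  -- the window step on every torus
  obtain ⟨β₇, Λ₇, hwin⟩ := windowFloors_of_floor_ceiling_localisation G r a v f κ ε β₅ Λ₅ C Λ T₀ η hapos hanti
    hratio hε hΛ2 hT₀1 hexp hceil (min_le_left _ _) (min_le_right _ _) hfloor hCv hlocv
  have hpos8 : 0 < ε / (8 * T₀) := by positivity
  refine ⟨r, a, v, f, min (ε / 2) (ε / (8 * T₀)), T₀, Λ₇, β₇, hvcpt, hvsupp, hfv, hfθ, hdisj, hapos, hlim,
    lt_min (half_pos hε) hpos8, hT₀.le, ?_⟩
  intro c₀ hc₀ L hL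
  obtain ⟨c, hc₀c, hcT, h2, h3⟩ := hwin c₀ hc₀ L hL
  exact ⟨c, hc₀c, hcT, (min_le_left _ _).trans h2, (min_le_right _ _).trans h3⟩

/-- Archimedean threshold: for `0 < u` there is `L₀ : ℕ` with `M ≤ u·(n + L₀)` for all `n`. [bookkeeping] -/
private theorem exists_threshold (M : ℝ) {u : ℝ} (hu : 0 < u) :
    ∃ L₀ : ℕ, ∀ n : ℕ, M ≤ u * ((n + L₀ : ℕ) : ℝ) := by
  refine ⟨⌈M / u⌉₊, fun n => ?_⟩
  have h1 : M / u ≤ (⌈M / u⌉₊ : ℝ) := Nat.le_ceil _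
  have h2 : (⌈M / u⌉₊ : ℝ) ≤ ((n + ⌈M / u⌉₊ : ℕ) : ℝ) := by exact_mod_cast Nat.le_add_left _ _
  have h3 : M / u * u = M := div_mul_cancel₀ M hu.ne'
  nlinarith [h1, h2, hu]

/-- A near-top `∀L`-floor unit: if some unit `s₀ ∈ (0,1]` has property `Fl`, there is a unit `w ∈ (0,1]` with `Fl`,
above half the supremum of such units — so no unit in `[2w, 1]` has `Fl`, and `w < 2s` for every unit `s` whose
`[2s, 1]` is `Fl`-free. [folklore; the selection behind «onset»] -/
private theorem exists_onset_unit (Fl : ℝ → Prop) {s₀ : ℝ} (hs₀0 : 0 < s₀) (hs₀1 : s₀ ≤ 1) (hFl : Fl s₀) :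
    ∃ w : ℝ, 0 < w ∧ w ≤ 1 ∧ Fl w ∧ (∀ s' : ℝ, 2 * w ≤ s' → s' ≤ 1 → ¬ Fl s') ∧
      (∀ s : ℝ, (∀ s' : ℝ, 2 * s ≤ s' → s' ≤ 1 → ¬ Fl s') → w < 2 * s) := by
  set P : Set ℝ := {s' : ℝ | 0 < s' ∧ s' ≤ 1 ∧ Fl s'} with hPdef
  have hs₀P : s₀ ∈ P := ⟨hs₀0, hs₀1, hFl⟩
  have hne : P.Nonempty := ⟨s₀, hs₀P⟩
  have hbdd : BddAbove P := ⟨1, fun s' hs' => hs'.2.1⟩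
  have hσ : 0 < sSup P := lt_of_lt_of_le hs₀0 (le_csSup hbdd hs₀P)
  obtain ⟨w, hwP, hσw⟩ := exists_lt_of_lt_csSup hne (half_lt_self hσ)
  refine ⟨w, hwP.1, hwP.2.1, hwP.2.2, fun s' h1 h2 hF => ?_, fun s hguard => ?_⟩
  · have hle := le_csSup hbdd (show s' ∈ P from ⟨by linarith [hwP.1], h2, hF⟩)
    linarith
  · by_contra hge
    exact hguard w (not_lt.1 hge) hwP.2.1 hwP.2.2

/-- **E_AM ⟹ item 26791 `AxisMirrorCeiling` BY NAME (kernel-checked).**  Under 26791's `∀β` antecedent every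
`β ≥ β₅` has a `∀L`-floor unit; the near-top such unit `w` (`exists_onset_unit`) satisfies E_AM's hypotheses (a), (b),
and `w < 2s` for every guarded unit `s` of 26791, so E_AM's ceiling at `w` with `ℓ₄` serves 26791 at `s` with `ℓ₄/2`
(the conclusion does not involve the unit). -/
theorem axisMirrorCeiling_of_onset (hE : AxisMirrorCeilingOnset) :
    Summit.QuantumFields.YangMills.Theses.SquareRootCeilings.AxisMirrorCeiling := by
  intro G _ _ _ _ hG hcl
  letI : MeasurableSpace G := borel G
  haveI : BorelSpace G := ⟨rfl⟩
  intro r v f g h Λ₅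
  obtain ⟨ε₀, hε₀, h1⟩ := hE G hG hcl r v f g h Λ₅
  refine ⟨ε₀, hε₀, fun ε hε hεε hFloors => ?_⟩
  obtain ⟨C, ℓ₄, β₄, hℓ₄, hC, h2⟩ := h1 ε hε hεε
  obtain ⟨β₅, hβ₅⟩ := hFloors
  refine ⟨C, ℓ₄ / 2, max β₄ β₅, half_pos hℓ₄, hC, ?_⟩
  intro β hβ s hs hs1 hsub L q k R t hq hR hRs hRL ht htL
  have hβ4 : β₄ ≤ β := le_trans (le_max_left _ _) hβ
  have hβ5 : β₅ ≤ β := le_trans (le_max_right _ _) hβ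
  obtain ⟨s₀, hs₀0, hs₀1, hF2, hF3⟩ := hβ₅ β hβ5
  obtain ⟨w, hw0, hw1, hFw, hguardw, hwlt⟩ := exists_onset_unit
    (fun s' : ℝ => (∀ L : ℕ, Λ₅ ≤ s' * L → ε ≤ Q2 G r β L s' (thetaTest 4 v) v) ∧
      (∀ L : ℕ, Λ₅ ≤ s' * L → ε ≤ |Q3 G r β L s' f g h|)) hs₀0 hs₀1 ⟨hF2, hF3⟩
  have hw2s : w < 2 * s := hwlt s hsub
  obtain ⟨L₀, hL₀⟩ := exists_threshold Λ₅ hw0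
  have hRw : (R : ℝ) * w ≤ ℓ₄ :=
    calc (R : ℝ) * w ≤ (R : ℝ) * (2 * s) := mul_le_mul_of_nonneg_left hw2s.le (Nat.cast_nonneg R)
      _ = 2 * ((R : ℝ) * s) := by ring
      _ ≤ ℓ₄ := by linarith
  exact h2 β hβ4 w hw0 hw1 ⟨fun j => j + L₀, fun i j hij => Nat.add_lt_add_right hij L₀,
      fun j => ⟨hFw.1 _ (hL₀ j), hFw.2 _ (hL₀ j)⟩⟩ hguardw L q k R t hq hR hRw hRL ht htL

/-- **E ⟹ item 26671 `SubOnsetTwoPointCeilings` BY NAME (kernel-checked; same selection).** -/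
theorem subOnsetTwoPointCeilings_of_onset (hE : SubOnsetTwoPointCeilingsOnset) :
    Summit.QuantumFields.YangMills.Theses.SquareRootCeilings.SubOnsetTwoPointCeilings := by
  intro G _ _ _ _ hG hcl
  letI : MeasurableSpace G := borel G
  haveI : BorelSpace G := ⟨rfl⟩
  intro r v f g h Λ₅
  obtain ⟨ε₀, hε₀, h1⟩ := hE G hG hcl r v f g h Λ₅
  refine ⟨ε₀, hε₀, fun ε hε hεε hFloors => ?_⟩
  obtain ⟨C, ℓ₄, β₄, hℓ₄, hC, h2⟩ := h1 ε hε hεε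
  obtain ⟨β₅, hβ₅⟩ := hFloors
  refine ⟨C, ℓ₄ / 2, max β₄ β₅, half_pos hℓ₄, hC, ?_⟩
  intro β hβ s hs hs1 hsub L q q' x y R hq hq' hR hRs hRL hsep
  have hβ4 : β₄ ≤ β := le_trans (le_max_left _ _) hβ
  have hβ5 : β₅ ≤ β := le_trans (le_max_right _ _) hβ
  obtain ⟨s₀, hs₀0, hs₀1, hF2, hF3⟩ := hβ₅ β hβ5
  obtain ⟨w, hw0, hw1, hFw, hguardw, hwlt⟩ := exists_onset_unit
    (fun s' : ℝ => (∀ L : ℕ, Λ₅ ≤ s' * L → ε ≤ Q2 G r β L s' (thetaTest 4 v) v) ∧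
      (∀ L : ℕ, Λ₅ ≤ s' * L → ε ≤ |Q3 G r β L s' f g h|)) hs₀0 hs₀1 ⟨hF2, hF3⟩
  have hw2s : w < 2 * s := hwlt s hsub
  obtain ⟨L₀, hL₀⟩ := exists_threshold Λ₅ hw0
  have hRw : (R : ℝ) * w ≤ ℓ₄ :=
    calc (R : ℝ) * w ≤ (R : ℝ) * (2 * s) := mul_le_mul_of_nonneg_left hw2s.le (Nat.cast_nonneg R)
      _ = 2 * ((R : ℝ) * s) := by ring
      _ ≤ ℓ₄ := by linarith
  exact h2 β hβ4 w hw0 hw1 ⟨fun j => j + L₀, fun i j hij => Nat.add_lt_add_right hij L₀,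
      fun j => ⟨hFw.1 _ (hL₀ j), hFw.2 _ (hL₀ j)⟩⟩ hguardw L q q' x y R hq hq' hR hRw hRL hsep

/-- **SELECTION (kernel-checked): window floors + coupling equicontinuity ⟹ cofinal floors** (Schwartz source; the
proof of LINE «CofinalWindows» `cofinalFloorsK_of_windows` verbatim up to the witness bookkeeping).  Per window
`c₀(k) = B + k`: the couplings `c(L) ∈ [c₀, c₀+T₀]` have a convergent subsequence `c(L_j) → β_k` (Bolzano–Weierstrass);
the Lipschitz bound moves the floors `ε` at `(c(L_j), L_j)` to floors `ε/2` at `(β_k, L_j)` eventually in `j`. -/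
theorem cofinalFloorsS_of_windows (h1 : WindowFloorsS) (h2 : WindowLipschitz) : CofinalFloorsS := by
  intro G _ _ _ _ hG hcl
  letI : MeasurableSpace G := borel G
  haveI : BorelSpace G := ⟨rfl⟩
  obtain ⟨r, a, v, f, ε, T₀, Λ₅, β₅, hvK, hv, hfv, hfθ, hθv, hapos, ha0, hε, hT₀, hW⟩ := h1 G hG hcl
  obtain ⟨K₂, Λ₆, β₆, hK₂, hL2⟩ := h2 G hG hcl r a v f (thetaTest 4 v) v ε T₀ Λ₅ β₅ hvK (hasCompactSupport_thetaTest' hvK) hvK hv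
    hfθ hθv hfv hapos ha0 hε hT₀ hW
  obtain ⟨K₃, Λ₇, β₇, hK₃, hL3⟩ := h2 G hG hcl r a v f (thetaTest 4 v) v ε T₀ Λ₅ β₅ hvK (hasCompactSupport_thetaTest' hvK) hvK hv
    hfθ hθv hfv hapos ha0 hε hT₀ hW
  -- a base coupling beyond which the unit is `≤ 1`
  obtain ⟨B₀, hB₀⟩ : ∃ B₀ : ℝ, ∀ c, B₀ ≤ c → a c ≤ 1 :=
    Filter.eventually_atTop.1 (ha0.eventually (eventually_le_nhds one_pos))
  set B : ℝ := max (max β₅ B₀) (max β₆ β₇) with hBdef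
  have hB5 : β₅ ≤ B := (le_max_left _ _).trans (le_max_left _ _)
  have hB0 : B₀ ≤ B := (le_max_right _ _).trans (le_max_left _ _)
  have hB6 : β₆ ≤ B := (le_max_left _ _).trans (le_max_right _ _)
  have hB7 : β₇ ≤ B := (le_max_right _ _).trans (le_max_right _ _)
  have hBk : ∀ k : ℕ, B ≤ B + (k : ℝ) := fun k => le_add_of_nonneg_right (Nat.cast_nonneg k)
  -- the per-window selection
  have key : ∀ k : ℕ, ∃ (β' : ℝ) (S : ℕ → ℕ), B + (k : ℝ) ≤ β' ∧ StrictMono S ∧ ∀ j,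
      ε / 2 ≤ Q2 G r β' (S j) (a (B + k)) (thetaTest 4 v) v ∧
      ε / 2 ≤ |Q3 G r β' (S j) (a (B + k)) f (thetaTest 4 v) v| := by
    intro k
    set c₀ : ℝ := B + (k : ℝ) with hc₀def
    have hc₀5 : β₅ ≤ c₀ := hB5.trans (hBk k)
    have hc₀6 : β₆ ≤ c₀ := hB6.trans (hBk k)
    have hc₀7 : β₇ ≤ c₀ := hB7.trans (hBk k)
    have hs : 0 < a c₀ := hapos c₀
    have hs1 : a c₀ ≤ 1 := hB₀ c₀ (hB0.trans (hBk k))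
    obtain ⟨L₀, hL₀⟩ := exists_threshold (max Λ₅ (max Λ₆ Λ₇)) hs
    have hthr5 : ∀ n : ℕ, Λ₅ ≤ a c₀ * ((n + L₀ : ℕ) : ℝ) := fun n => (le_max_left _ _).trans (hL₀ n)
    have hthr6 : ∀ n : ℕ, Λ₆ ≤ a c₀ * ((n + L₀ : ℕ) : ℝ) :=
      fun n => ((le_max_left _ _).trans (le_max_right _ _)).trans (hL₀ n)
    have hthr7 : ∀ n : ℕ, Λ₇ ≤ a c₀ * ((n + L₀ : ℕ) : ℝ) :=
      fun n => ((le_max_right _ _).trans (le_max_right _ _)).trans (hL₀ n)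
    have hWn : ∀ n : ℕ, ∃ c : ℝ, c₀ ≤ c ∧ c ≤ c₀ + T₀ ∧
        ε ≤ Q2 G r c (n + L₀) (a c₀) (thetaTest 4 v) v ∧ ε ≤ |Q3 G r c (n + L₀) (a c₀) f (thetaTest 4 v) v| :=
      fun n => hW c₀ hc₀5 (n + L₀) (hthr5 n)
    choose c hc using hWn
    -- Bolzano–Weierstrass on the window
    obtain ⟨β', hβ'cl, φ, hφ, hlim⟩ :=
      tendsto_subseq_of_bounded (Metric.isBounded_Icc c₀ (c₀ + T₀)) (x := c) (fun n => ⟨(hc n).1, (hc n).2.1⟩)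
    have hβ'mem : β' ∈ Set.Icc c₀ (c₀ + T₀) := by rwa [closure_Icc] at hβ'cl
    -- the Lipschitz errors go to zero along the subsequence
    have habs : Tendsto (fun j => |c (φ j) - β'|) atTop (nhds 0) := by
      have h0 : Tendsto (fun j => c (φ j) - β') atTop (nhds (β' - β')) := hlim.sub_const β'
      rw [sub_self] at h0
      simpa using h0.abs
    have hsmall : ∀ᶠ j in atTop, K₂ * |c (φ j) - β'| ≤ ε / 2 ∧ K₃ * |c (φ j) - β'| ≤ ε / 2 := by
      have h2' : Tendsto (fun j => K₂ * |c (φ j) - β'|) atTop (nhds 0) := by simpa using habs.const_mul K₂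
      have h3' : Tendsto (fun j => K₃ * |c (φ j) - β'|) atTop (nhds 0) := by simpa using habs.const_mul K₃
      exact (h2'.eventually (eventually_le_nhds (half_pos hε))).and
        (h3'.eventually (eventually_le_nhds (half_pos hε)))
    obtain ⟨j₀, hj₀⟩ := Filter.eventually_atTop.1 hsmall
    refine ⟨β', fun j => φ (j + j₀) + L₀, hβ'mem.1, ?_, ?_⟩
    · intro i j hij
      exact Nat.add_lt_add_right (hφ (Nat.add_lt_add_right hij j₀)) L₀
    · intro j
      obtain ⟨h2s, h3s⟩ := hj₀ (j + j₀) (Nat.le_add_left _ _)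
      obtain ⟨hcl, hcu, hfl2, hfl3⟩ := hc (φ (j + j₀))
      have hLip2 := (hL2 c₀ hc₀6 (c (φ (j + j₀))) β' hcl hcu hβ'mem.1 hβ'mem.2 (φ (j + j₀) + L₀) (hthr6 _)).1
      have hLip3 := (hL3 c₀ hc₀7 (c (φ (j + j₀))) β' hcl hcu hβ'mem.1 hβ'mem.2 (φ (j + j₀) + L₀) (hthr7 _)).2
      refine ⟨?_, ?_⟩
      · have hd := (abs_sub_le_iff.1 (hLip2.trans h2s)).1
        linarith
      · have hd := hLip3.trans h3s
        have htri := abs_sub_abs_le_abs_sub (Q3 G r (c (φ (j + j₀))) (φ (j + j₀) + L₀) (a c₀) f (thetaTest 4 v) v)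
          (Q3 G r β' (φ (j + j₀) + L₀) (a c₀) f (thetaTest 4 v) v)
        linarith
  choose βk S hβk hS hfl using key
  refine ⟨r, βk, fun k => a (B + k), v, f, ε / 2, hvK, hv, hfv, hfθ, hθv,
    fun k => hapos _, fun k => hB₀ _ (hB0.trans (hBk k)), ?_, ?_, half_pos hε, fun k => ⟨S k, hS k, hfl k⟩⟩
  · exact ha0.comp (tendsto_atTop_add_const_left atTop B tendsto_natCast_atTop_atTop)
  · exact tendsto_atTop_mono hβk (tendsto_atTop_add_const_left atTop B tendsto_natCast_atTop_atTop)

/-- **`CofinalSubOnsetFloorsS` — cofinal joint floors at a SUB-ONSET unit (Schwartz source).**  For every SU(2)-class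
`G`: `r`, a compactly supported positive-time `v`, a Schwartz `f` (`f, θv, v` pairwise disjointly supported), a level
`ε₁ > 0`, and for EVERY threshold `Λ₅` and EVERY level `0 < ε ≤ ε₁`: couplings `β_k → ∞`, units `w_k ∈ (0,1]` with
`w_k → 0`, such that for every `k` (a) both floors of level `ε` hold at `(β_k, w_k)` along a strictly increasing
odd-torus sequence and (b) no scale `s' ∈ [2w_k, 1]` carries the two `∀L`-floors of level `ε` (threshold `Λ₅`) at
`β_k` — the antecedent of E `SubOnsetTwoPointCeilingsOnset` at `(r, v, f, θv, v, Λ₅)`. -/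
def CofinalSubOnsetFloorsS : Prop :=
  ∀ (G : Type) [Group G] [TopologicalSpace G] [IsTopologicalGroup G] [CompactSpace G],
    IsCompactSimpleLieGroup G → Nonempty (G ≃ₜ* Matrix.specialUnitaryGroup (Fin 2) ℂ) →
    letI : MeasurableSpace G := borel G
    haveI : BorelSpace G := ⟨rfl⟩
    ∃ (r : LatticeRep G) (v f : SchwartzMap (EuclideanSpace ℝ (Fin 4)) ℝ) (ε₁ : ℝ),
      HasCompactSupport (v : EuclideanSpace ℝ (Fin 4) → ℝ) ∧ tsupport v ⊆ {y : EuclideanSpace ℝ (Fin 4) | 0 < y 0} ∧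
      Disjoint (tsupport f) (tsupport v) ∧ Disjoint (tsupport f) (tsupport (thetaTest 4 v)) ∧
      Disjoint (tsupport (thetaTest 4 v)) (tsupport v) ∧ 0 < ε₁ ∧
      ∀ (Λ₅ ε : ℝ), 0 < ε → ε ≤ ε₁ → ∃ (βk w : ℕ → ℝ),
        (∀ k, 0 < w k) ∧ (∀ k, w k ≤ 1) ∧ Tendsto w atTop (nhds 0) ∧ Tendsto βk atTop atTop ∧
        ∀ k, (∃ S : ℕ → ℕ, StrictMono S ∧ ∀ j,
              ε ≤ Q2 G r (βk k) (S j) (w k) (thetaTest 4 v) v ∧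
              ε ≤ |Q3 G r (βk k) (S j) (w k) f (thetaTest 4 v) v|) ∧
          (∀ s' : ℝ, 2 * w k ≤ s' → s' ≤ 1 →
            ¬ ((∀ L : ℕ, Λ₅ ≤ s' * L → ε ≤ Q2 G r (βk k) L s' (thetaTest 4 v) v) ∧
               (∀ L : ℕ, Λ₅ ≤ s' * L → ε ≤ |Q3 G r (βk k) L s' f (thetaTest 4 v) v|)))

/-- **ENGINE-a′ (kernel-checked): cofinal floors ⟹ cofinal floors at a sub-onset unit** (exhaustive case split per
`k`: the near-maximal `∀L`-floor scale in `[2u_k, 1]` via `sSup`, else `u_k`; `w_k → 0` by the landed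
`OnsetCalibration.onsetVanishes_proof`, which needs no compactness). -/
theorem cofinalSubOnsetFloorsS_of_cofinalFloorsS (h1 : CofinalFloorsS) : CofinalSubOnsetFloorsS := by
  intro G _ _ _ _ hG hcl
  letI : MeasurableSpace G := borel G
  haveI : BorelSpace G := ⟨rfl⟩
  obtain ⟨r, βk, u, v, f, ε₁, hvK, hv, hfv, hfθ, hθv, hu0, hu1, hu, hβ, hε₁, hfl⟩ := h1 G hG hcl
  refine ⟨r, v, f, ε₁, hvK, hv, hfv, hfθ, hθv, hε₁, fun Λ₅ ε hε hεε₁ => ?_⟩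
  have key : ∀ k : ℕ, ∃ w : ℝ, u k ≤ w ∧ w ≤ 1 ∧
      (∃ S : ℕ → ℕ, StrictMono S ∧ ∀ j,
        ε ≤ Q2 G r (βk k) (S j) w (thetaTest 4 v) v ∧ ε ≤ |Q3 G r (βk k) (S j) w f (thetaTest 4 v) v|) ∧
      (∀ s' : ℝ, 2 * w ≤ s' → s' ≤ 1 →
        ¬ ((∀ L : ℕ, Λ₅ ≤ s' * L → ε ≤ Q2 G r (βk k) L s' (thetaTest 4 v) v) ∧
           (∀ L : ℕ, Λ₅ ≤ s' * L → ε ≤ |Q3 G r (βk k) L s' f (thetaTest 4 v) v|))) ∧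
      (w = u k ∨
        ((∀ L : ℕ, Λ₅ ≤ w * L → ε ≤ Q2 G r (βk k) L w (thetaTest 4 v) v) ∧
         (∀ L : ℕ, Λ₅ ≤ w * L → ε ≤ |Q3 G r (βk k) L w f (thetaTest 4 v) v|))) := by
    intro k
    have huk : 0 < u k := hu0 k
    by_cases hA : ∃ s' : ℝ, 2 * u k ≤ s' ∧ s' ≤ 1 ∧
        ((∀ L : ℕ, Λ₅ ≤ s' * L → ε ≤ Q2 G r (βk k) L s' (thetaTest 4 v) v) ∧
         (∀ L : ℕ, Λ₅ ≤ s' * L → ε ≤ |Q3 G r (βk k) L s' f (thetaTest 4 v) v|))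
    · set P : Set ℝ := {s' : ℝ | 2 * u k ≤ s' ∧ s' ≤ 1 ∧
        ((∀ L : ℕ, Λ₅ ≤ s' * L → ε ≤ Q2 G r (βk k) L s' (thetaTest 4 v) v) ∧
         (∀ L : ℕ, Λ₅ ≤ s' * L → ε ≤ |Q3 G r (βk k) L s' f (thetaTest 4 v) v|))} with hPdef
      have hPne : P.Nonempty := hA
      have hPbdd : BddAbove P := ⟨1, fun s' hs' => hs'.2.1⟩
      obtain ⟨s₀, hs₀⟩ := hA
      have hσpos : 0 < sSup P := lt_of_lt_of_le (by linarith [hs₀.1]) (le_csSup hPbdd hs₀)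
      obtain ⟨w, hwP, hσw⟩ := exists_lt_of_lt_csSup hPne (half_lt_self hσpos)
      have hw0 : 0 < w := by linarith [hwP.1]
      obtain ⟨L₀, hL₀⟩ := exists_threshold Λ₅ hw0
      refine ⟨w, by linarith [hwP.1], hwP.2.1, ⟨fun j => j + L₀, fun i j hij => Nat.add_lt_add_right hij L₀,
        fun j => ⟨hwP.2.2.1 _ (hL₀ j), hwP.2.2.2 _ (hL₀ j)⟩⟩, ?_, Or.inr hwP.2.2⟩
      intro s' hs'1 hs'2 hFl
      have hs'P : s' ∈ P := ⟨by linarith [hwP.1], hs'2, hFl⟩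
      have hle := le_csSup hPbdd hs'P
      linarith
    · obtain ⟨S, hS, hflS⟩ := hfl k
      exact ⟨u k, le_rfl, hu1 k, ⟨S, hS, fun j => ⟨hεε₁.trans (hflS j).1, hεε₁.trans (hflS j).2⟩⟩,
        fun s' h1 h2 hFl => hA ⟨s', h1, h2, hFl⟩, Or.inl rfl⟩
  choose w hwu hw1 hwS hwsub hwcase using key
  have hwpos : ∀ k, 0 < w k := fun k => lt_of_lt_of_le (hu0 k) (hwu k)
  refine ⟨βk, w, hwpos, hw1, ?_, hβ, fun k => ⟨hwS k, hwsub k⟩⟩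
  rw [Metric.tendsto_atTop]
  intro δ hδ
  obtain ⟨β₁, hβ₁⟩ :=
    Summit.QuantumFields.YangMills.Theorems.OnsetCalibration.onsetVanishes_proof G hG hcl r v f (thetaTest 4 v) v ε
      Λ₅ δ hε hδ
  obtain ⟨k₁, hk₁⟩ := Filter.eventually_atTop.1 (hβ.eventually_ge_atTop β₁)
  obtain ⟨k₂, hk₂⟩ := (Metric.tendsto_atTop.1 hu) δ hδ
  refine ⟨max k₁ k₂, fun k hk => ?_⟩
  have hk1 : β₁ ≤ βk k := hk₁ k ((le_max_left _ _).trans hk)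
  have hk2 := hk₂ k ((le_max_right _ _).trans hk)
  rw [Real.dist_0_eq_abs, abs_of_pos (hu0 k)] at hk2
  rw [Real.dist_0_eq_abs, abs_of_pos (hwpos k)]
  rcases hwcase k with hB | hFl
  · rw [hB]; exact hk2
  · by_contra hge
    exact hβ₁ (βk k) hk1 (w k) (not_lt.1 hge) (hw1 k) hFl

/-! ## §3 The registered stubs -/

/-- ★ **R1 `stub_responseLocalisation`** — FRS's deciding crux BY NAME (item stmt-QuantumFields-26871, «SIGNED-COLLAR»:
the signed smooth-collar share of the Feynman–Hellmann response is `≤ η(1 + |∂_cQ2|)`).  [N-wall contact; shared with FRS] -/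
theorem stub_responseLocalisation : ResponseLocalisation := by
  sorry

/-- ★ **R2 `stub_runningCouplingCeiling`** — FRS's asymptotic-freedom ceiling BY NAME (item stmt-QuantumFields-24275:
`Q2 ≤ C/log²Λ` at scales finer than the unit, uniformly over normalised sources).  [UV ceiling; shared with FRS] -/
theorem stub_runningCouplingCeiling : RunningCouplingCeiling := by
  sorry

/-- ★ **R3 `stub_floorRatioFar`** — FRS's residual WITHOUT its scaling limits: clause-(i) floor of the shrinking family
(NT clause (i): PerturbativeInvisibility-class, honest), antitone unit with ratio law (dimensional transmutation as a
law of the unit), far-field response ceiling (IR).  Strictly weaker than `FloorWithScalingLimits`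
(`floorRatioFar_of_floorWithScalingLimits`).  [residual; N-wall (i) + IR] -/
theorem stub_floorRatioFar : FloorRatioFar := by
  sorry

/-- ★ **N2′ `stub_windowResponseBound`** (CORRECTED currency) — the window response bound: wherever window floors hold (N1's
property, disjointly supported tests, unit `a(c₀)`), the coupling derivative of the smeared torus two- and
three-point functions at that unit is bounded by ONE `K` across every window `[c₀, c₀+T₀]`, uniformly in the volume
(Feynman–Hellmann: the smeared third / fourth cumulant with one leg summed against the action over the torus — a
response ceiling at the floors' unit; E-wall-adjacent upper-bound class, n = 2, 3, derivative form; contact terms are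
absent because the tests are disjointly supported, the infrared regime `s ≪ a(β)` is absent because the unit is the
floors' own).  N2 follows (`windowLipschitz_of_responseBound`). -/
theorem stub_windowResponseBound : WindowResponseBound := by
  sorry

/-- ★ **E_AM `stub_axisMirrorCeilingOnset`** (REV 7∕6: onset-conditioned form of item 26791, idea-crit-9 #90c P2 form β)
— the on-axis same-orientation mirror-pair plaquette ceiling `(C/R⁴)²` at axis separations `t ∈ [2R+2, L]`,
`R s ≤ ℓ₄`, owed at every `(β ≥ β₄, s)` where `s` carries the tests' floors along a torus sequence and no unit in
`[2s,1]` carries `∀L`-floors (floor-less instances vacuous).  `⇒ 26791` and `⇒ E ⇒ 26671` BY NAME (proved above).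
[E-wall, n = 2, on-axis; SU(2)-class; the open content of route SquareRootCeilings] -/
theorem stub_axisMirrorCeilingOnset : AxisMirrorCeilingOnset := by
  sorry

/-- ★ **E′ `stub_smearedMomentBound`** — OnsetTautology's smeared all-order ceiling currency BY NAME (conclusion of
the landed E3 from AtomicSynthesis 28167 / AtomicSqrtDominationR 28168 / OnsetContraction).  [E-wall n ≥ 2; by name] -/
theorem stub_smearedMomentBound : SmearedMomentBound := by
  sorry

/-- ★ **ENGINE-b `stub_cofinalEngineBS`** (SOFT, provable-grade, L/XL; REV 2) — the cofinal re-run of the landed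
calibration and IV engines from the SUB-ONSET cofinal currency with a Schwartz three-point source (steps (1) selection
and (2) sub-onset unit are PROVED: `cofinalFloorsS_of_windows`, `cofinalSubOnsetFloorsS_of_cofinalFloorsS`): fix `Λ₅`
and `ε := min ε₁ ε₀` (E at `(r, v, f, θv, v, Λ₅)`); (3) E's ceiling at `(β_k, w_k)` (its antecedent is clause (b)),
inherited by the odd-torus limit states ALONG the floor subsequence (`twoPoint_limitState`), onset domination
(`rpSquare_le_coarse/fine`), E′ at `(β_k, μ_k, K w_k)`; (4) `smearedIVDataK_proof` along `k`, the three-point floor with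
the Schwartz source transferred to `μ_k` by dominated convergence (bounded plaquette cumulants × Schwartz tails, uniform
in `L`); the leaf's unit function interpolates `w_k` at `β_k`.  No `∀β` statement is used. -/
theorem stub_cofinalEngineBS :
    CofinalSubOnsetFloorsS → SubOnsetTwoPointCeilingsOnset → SmearedMomentBound →
      Summit.QuantumFields.YangMills.Theses.InfiniteVolumeContinuum.HypercubicOSDataFromInfiniteVolume := by
  sorry

/-! ## §4 The composition (sorry-free) -/

/-- **The composition (REV 2).**  FRS's two cruxes + its residual WITHOUT scaling limits ⟹ (proved window step on
every torus) window floors; N2′ ⟹ (MVT, proved) coupling equicontinuity; ⟹ (proved selection) cofinal floors ⟹ (proved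
ENGINE-a′) cofinal floors at a sub-onset unit; with E and E′ ⟹ the leaf through ENGINE-b. -/
theorem HypercubicOSDataFromInfiniteVolume_of_cofinalFRS :
    Summit.QuantumFields.YangMills.Theses.InfiniteVolumeContinuum.HypercubicOSDataFromInfiniteVolume :=
  stub_cofinalEngineBS
    (cofinalSubOnsetFloorsS_of_cofinalFloorsS
      (cofinalFloorsS_of_windows
        (windowFloorsS_of_FRS stub_floorRatioFar stub_runningCouplingCeiling stub_responseLocalisation)
        (windowLipschitz_of_responseBound stub_windowResponseBound)))
    (subOnsetTwoPointCeilingsOnset_of_axisMirrorOnset stub_axisMirrorCeilingOnset) stub_smearedMomentBound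

end Summit.QuantumFields.YangMills.Cruxes.HypercubicOSDataFromInfiniteVolume.CofinalFRS

end
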